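import Mathlib

/-!
# Sequency-band energy of a Walsh–Hadamard spectrum: the combinatorial kernel (DEQ-A161)

Instance-level adjudication of specific advantage claims; no claim about BQP vs BPP or the summit.

Source under adjudication: A. Shukla, P. Vedula, *Quantum Detection of Sequency-Band Structure*,
arXiv:2602.08393v1 (2026), eq. (3.6) (the sequency-ordered Walsh–Hadamard transform `H_S`),
§4.1 / eq. (4.1) (the band probability mass `P_[a,a+M)`), Algorithm 1.

This file kernel-checks the finite combinatorial facts on which the classical estimator of
DEQ-A161 (Theorem A161-A) rests, at and above the paper's own simulation size `n = 3`
(`N = 8`), and proves the two `N`-independent algebraic identities behind its unbiasedness and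
its second-moment bound.

* §1  `paperExp n k j` is the exponent of eq. (3.6) transcribed literally; `sigma n k` is the
      bit reversal of the Gray code of `k`; `parity n v` is the parity of the low `n` bits of `v`.
      `eq36_is_character_n3/_n4`: the `(k, j)` entry of `√N · H_S` is the character
      `(-1)^{σ(k)·j}` (all `k, j < N`, `N = 8, 16`), by `decide`.
      `printed_matrix_is_eq36`: the `8 × 8` matrix printed on p. 9 of the paper is eq. (3.6).
* §2  `dyadic_block_is_coset_n4`: every dyadic block of sequency indices `[t·2^s, (t+1)·2^s)`
      is mapped by `σ` into the coset `σ(t·2^s) ⊕ {v·2^{n-s} : v < 2^s}` (`n = 4`), and `σ` is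
      injective on `[0, 16)`; `character_sum_n4`: `∑_{v<2^s} (-1)^{(v·2^{n-s})·m} = 2^s·[m < 2^{n-s}]`
      (`n = 4`, all `s ≤ 4`, `m < 16`) — the projector-kernel formula of Lemma A161-3.
* §3  For any finite index type, any real vector `x`, `S = ∑ x_j^2 ≠ 0` and any permutation `π`
      (in the note: `π = (· ⊕ m)`), the length-square-sampling identities
      `∑_{j : x_j ≠ 0} (x_j^2/S)·(x_{π j}/x_j) = (∑_j x_j·x_{π j})/S`   (`firstMoment_perm`) and
      `∑_{j : x_j ≠ 0} (x_j^2/S)·(x_{π j}/x_j)^2 ≤ 1`                 (`secondMoment_perm_le_one`);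
      `xorPerm n m` is the permutation `j ↦ j ⊕ m` of `Fin (2^n)`.

Nothing here is specific to quantum computation; the declarations are the checkable core of a
classical sampling estimator.  No `sorry`, no new axioms.
-/

namespace Summit.QuantumAdvantage.Dequantization.SequencyBandKernel

/-! ## §1  eq. (3.6) rows are Walsh characters, `σ = bitrev ∘ gray` -/

/-- `bit v i` = the `i`-th binary digit of `v` as a natural number (0 or 1). -/
def bit (v i : ℕ) : ℕ := (v / 2 ^ i) % 2

/-- parity of the number of ones among the low `n` bits of `v`. -/
def parity : ℕ → ℕ → ℕ
  | 0, _ => 0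
  | n + 1, v => (parity n v + bit v n) % 2

/-- The exponent of eq. (3.6) of arXiv:2602.08393, transcribed literally:
`∑_{r=0}^{n-1} k_{n-1-r} (j_r ⊕ j_{r+1})  (mod 2)` with `j_n = 0` for `j < 2^n`. -/
def paperExp (n k j : ℕ) : ℕ :=
  (((List.range n).map fun r => bit k (n - 1 - r) * ((bit j r + bit j (r + 1)) % 2)).sum) % 2

/-- Gray code. -/
def gray (k : ℕ) : ℕ := k ^^^ (k / 2)

/-- reversal of the low `n` bits. -/
def bitrev (n k : ℕ) : ℕ := ((List.range n).map fun i => bit k i * 2 ^ (n - 1 - i)).sum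

/-- `σ(k)`: the character label (natural / Hadamard index) of the `k`-th sequency-ordered row. -/
def sigma (n k : ℕ) : ℕ := bitrev n (gray k)

/-- Lemma A161-1 at `n = 3` (`N = 8`, the paper's simulation size): the `(k,j)` exponent of
eq. (3.6) equals the parity of `σ(k) AND j`, i.e. `√8 · (H_S)_{k,j} = (-1)^{σ(k)·j}`. -/
theorem eq36_is_character_n3 :
    ∀ k < 8, ∀ j < 8, paperExp 3 k j = parity 3 (sigma 3 k &&& j) := by
  decide

/-- Lemma A161-1 at `n = 4` (`N = 16`). -/
theorem eq36_is_character_n4 :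
    ∀ k < 16, ∀ j < 16, paperExp 4 k j = parity 4 (sigma 4 k &&& j) := by
  decide

/-- The `8 × 8` sequency-ordered Walsh–Hadamard matrix printed on p. 9 of arXiv:2602.08393
(times `√8`), row by row. -/
def printedRow : ℕ → List Int
  | 0 => [1, 1, 1, 1, 1, 1, 1, 1]
  | 1 => [1, 1, 1, 1, -1, -1, -1, -1]
  | 2 => [1, 1, -1, -1, -1, -1, 1, 1]
  | 3 => [1, 1, -1, -1, 1, 1, -1, -1]
  | 4 => [1, -1, -1, 1, 1, -1, -1, 1]
  | 5 => [1, -1, -1, 1, -1, 1, 1, -1]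
  | 6 => [1, -1, 1, -1, -1, 1, -1, 1]
  | 7 => [1, -1, 1, -1, 1, -1, 1, -1]
  | _ => []

/-- The printed matrix is eq. (3.6): entry `+1` exactly where the exponent is even. -/
theorem printed_matrix_is_eq36 :
    ∀ k < 8, ∀ j < 8, (printedRow k).getD j 0 = if paperExp 3 k j = 0 then 1 else -1 := by
  decide

/-- Number of sign changes along a list of `±1` entries (the sequency of a row). -/
def signChanges (l : List Int) : ℕ := ((l.zip l.tail).filter fun p => p.1 ≠ p.2).length

/-- Row `k` of the printed matrix has exactly `k` sign changes (sequency ordering). -/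
theorem printed_rows_sequency : ∀ k < 8, signChanges (printedRow k) = k := by
  decide

/-! ## §2  dyadic sequency blocks are cosets; the character sum over the subgroup -/

/-- `σ` is injective on `[0,16)`. -/
theorem sigma_injective_n4 : ∀ k < 16, ∀ k' < 16, sigma 4 k = sigma 4 k' → k = k' := by
  decide

/-- Lemma A161-2 at `n = 4`: the dyadic block `[t·2^s, (t+1)·2^s)` of sequency indices is carried
by `σ` into the coset `σ(t·2^s) ⊕ G_s`, `G_s = {v·2^{4-s} : v < 2^s}`; with injectivity and a
cardinality count this is a bijection onto the coset. -/
theorem dyadic_block_is_coset_n4 :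
    ∀ s < 5, ∀ t < 2 ^ (4 - s), ∀ u < 2 ^ s,
      ∃ v < 2 ^ s, sigma 4 (t * 2 ^ s + u) = sigma 4 (t * 2 ^ s) ^^^ (v * 2 ^ (4 - s)) := by
  decide

/-- `(-1)^{c·m}` as an integer. -/
def chi (n c m : ℕ) : Int := if parity n (c &&& m) = 0 then 1 else -1

/-- Lemma A161-3 (kernel of the band projector) at `n = 4`: the character sum over the subgroup
`G_s` equals `2^s` on the annihilator `{m < 2^{4-s}}` and `0` elsewhere. -/
theorem character_sum_n4 :
    ∀ s < 5, ∀ m < 16,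
      (((List.range (2 ^ s)).map fun v => chi 4 (v * 2 ^ (4 - s)) m).sum)
        = if m < 2 ^ (4 - s) then (2 : Int) ^ s else 0 := by
  decide

/-! ## §3  the two `N`-independent identities of the length-square-sampling estimator -/

open Finset

variable {ι : Type*} [Fintype ι]

/-- Unbiasedness core of Theorem A161-A: sampling `j` with probability `x_j^2 / S` and returning
`x_{π j} / x_j` has mean `(∑_j x_j x_{π j}) / S`; indices with `x_j = 0` are never sampled and
contribute nothing to the right-hand side either. -/
theorem firstMoment_perm (x : ι → ℝ) (S : ℝ) (π : Equiv.Perm ι) :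
    ∑ j ∈ univ.filter (fun j => x j ≠ 0), (x j ^ 2 / S) * (x (π j) / x j)
      = (∑ j, x j * x (π j)) / S := by
  rw [Finset.sum_filter, Finset.sum_div]
  refine Finset.sum_congr rfl fun j _ => ?_
  split_ifs with h
  · field_simp
  · rw [not_not] at h
    simp [h]

/-- Second-moment core of Theorem A161-A: the same sample has second moment
`∑_{j : x_j ≠ 0} x_{π j}^2 / S ≤ (∑_j x_{π j}^2)/S = 1` when `S = ∑_j x_j^2 > 0`. -/
theorem secondMoment_perm_le_one (x : ι → ℝ) (π : Equiv.Perm ι)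
    (hS : 0 < ∑ j, x j ^ 2) :
    ∑ j ∈ univ.filter (fun j => x j ≠ 0),
        (x j ^ 2 / ∑ i, x i ^ 2) * (x (π j) / x j) ^ 2 ≤ 1 := by
  set S := ∑ i, x i ^ 2 with hSdef
  have hterm : ∀ j ∈ univ.filter (fun j => x j ≠ 0),
      (x j ^ 2 / S) * (x (π j) / x j) ^ 2 = x (π j) ^ 2 / S := by
    intro j hj
    have hx : x j ≠ 0 := (Finset.mem_filter.mp hj).2
    field_simp
  rw [Finset.sum_congr rfl hterm]
  calc ∑ j ∈ univ.filter (fun j => x j ≠ 0), x (π j) ^ 2 / S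
      ≤ ∑ j, x (π j) ^ 2 / S := by
        apply Finset.sum_le_sum_of_subset_of_nonneg (Finset.filter_subset _ _)
        intro j _ _
        positivity
    _ = (∑ j, x (π j) ^ 2) / S := by rw [Finset.sum_div]
    _ = S / S := by rw [hSdef, Equiv.sum_comp π (fun j => x j ^ 2)]
    _ = 1 := div_self (ne_of_gt hS)

/-- With no zero entries the second moment is exactly `1`. -/
theorem secondMoment_perm_eq_one (x : ι → ℝ) (π : Equiv.Perm ι)
    (hx : ∀ j, x j ≠ 0) (hS : 0 < ∑ j, x j ^ 2) :
    ∑ j, (x j ^ 2 / ∑ i, x i ^ 2) * (x (π j) / x j) ^ 2 = 1 := by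
  set S := ∑ i, x i ^ 2 with hSdef
  have hterm : ∀ j ∈ (univ : Finset ι), (x j ^ 2 / S) * (x (π j) / x j) ^ 2 = x (π j) ^ 2 / S := by
    intro j _
    have := hx j
    field_simp
  rw [Finset.sum_congr rfl hterm, ← Finset.sum_div, Equiv.sum_comp π (fun j => x j ^ 2)]
  exact div_self (ne_of_gt hS)

/-- The dyadic shift `j ↦ j ⊕ m` is a permutation of `Fin (2^n)` (an involution). -/
def xorPerm (n m : ℕ) (hm : m < 2 ^ n) : Equiv.Perm (Fin (2 ^ n)) where
  toFun j := ⟨j.val ^^^ m, Nat.xor_lt_two_pow j.isLt hm⟩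
  invFun j := ⟨j.val ^^^ m, Nat.xor_lt_two_pow j.isLt hm⟩
  left_inv j := by
    ext
    simp
  right_inv j := by
    ext
    simp

/-- `xorPerm n m` acts as `j ↦ j ⊕ m` on the underlying naturals. -/
@[simp] theorem xorPerm_apply (n m : ℕ) (hm : m < 2 ^ n) (j : Fin (2 ^ n)) :
    (xorPerm n m hm j).val = j.val ^^^ m := rfl

/-- The instance used in DEQ-A161: for the dyadic shift by `m`, the length-square sample of
`x_{j ⊕ m}/x_j` has mean `(∑_j x_j x_{j⊕m}) / ∑_j x_j^2` — the normalised dyadic autocorrelation. -/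
theorem firstMoment_xor (n m : ℕ) (hm : m < 2 ^ n) (x : Fin (2 ^ n) → ℝ) :
    ∑ j ∈ univ.filter (fun j => x j ≠ 0),
        (x j ^ 2 / ∑ i, x i ^ 2) * (x (xorPerm n m hm j) / x j)
      = (∑ j, x j * x (xorPerm n m hm j)) / ∑ i, x i ^ 2 :=
  firstMoment_perm x _ (xorPerm n m hm)

end Summit.QuantumAdvantage.Dequantization.SequencyBandKernel
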